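import Summits.FinalStateConjecture.FinalStateConjecture.Theorems.PhotonSphereChannelsKerrDevDefs
import HarnessLib

/-!
# Route PhotonSphereChannels · crux `ChannelsResolveTameDevelopmentsR` (K2R, stmt-FinalStateConjecture-14075) — re-basing
# of hull elements (line `kerr-isolation-dichotomy`, lead c2; stub-worker S3, audit of `stub_windowToGlobalBridge`)

A hull element `(𝓢, E, p)` of a development `𝒟` (`IsHullElement 𝒟 Λ r₀ q 𝓢 E p`: a future-escaping outer sequence `q`, a
`(Λ, r₀)`-tame end datum `E` of the limit `𝓢`, and pointed `C²_loc` subconvergence `(𝒟, q n) ⇀ (𝓢, p)`,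
`Spacetime.SubconvergesLocallyTo`) does not remember its base point: the SAME convergence datum, re-indexed so that a
prescribed point `p'` of the limit lies in the first set of the exhaustion, is a pointed `Cᵏ_loc` subconvergence
`(𝒟, q' n) ⇀ (𝓢, p')` for the new base sequence `q' (sub n) := embed n p'` (`subconvergesLocallyTo_rebase`, proved for
constant sequences of spacetimes, which is the hull case; pure bookkeeping over `Spacetime.LocalSubconvergence` —
`eventually_mem_U`, `subseq`, injectivity of `sub`). Consequently every point `p'` of the limit of a hull element carries
every clause of `IsHullElement … q' 𝓢 E p'` EXCEPT that the re-based sequence `q'` be outer and future-escaping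
(registered sub-goal `stub_hullElement_rebase`; `isHullElement_rebase` packages the remaining clause as a hypothesis).

Why this matters for S3 (`stub_windowToGlobalBridge`, whose conclusion constrains the END `E` only while its window
hypothesis constrains the geometry around the BASE POINTS): re-based at a far-chart point `p' = E.far y₀` of large radius,
where every tame end is window-close to the flat model at any fixed scale, a hull element keeps its end `E` and acquires a
base sequence satisfying S3's window hypothesis — the hypothesis is inert (lead's evidence file
`stub_windowToGlobalBridge_missing.lean`, principle `FarRebasing`, of which this file is the formal clause (FR2)).

References: Petersen 2006, Ch. 10 §3.2 (pointed convergence; the base point only fixes the exhaustion) [Petersen2006];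
Anderson 2004, Def. 1.1 [Anderson2004].
-/

noncomputable section

-- the operator-norm instance on `E4 →L[ℝ] E4 →L[ℝ] ℝ` needs one more level of pending
-- instance problems than the default (as in `PhotonSphereChannelsKerrDevDefs.lean`)
set_option maxSynthPendingDepth 3
-- every `Summit.FinalStateConjecture.FinalStateConjecture.…` name repeats the summit = sub-problem segment (D-0017 layout)
set_option linter.dupNamespace false

open Set Filter Function TopologicalSpace Manifold Bundle
open scoped Topology Manifold ContDiff ENNReal NNReal

namespace Summit.FinalStateConjecture.FinalStateConjecture.Theorems

open Literature.Geometry.Lorentzian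
open Summit.FinalStateConjecture.FinalStateConjecture.Theorems.TameHull

/-! ### Re-basing a pointed `Cᵏ_loc` subconvergence datum (constant sequence of spacetimes) -/

/-- **Re-basing the data.** Given a `LocalSubconvergence` datum of `(𝓣, q n)` to `(𝓢, p)` and ANY point `p'` of the limit,
there are a base sequence `q'` in `𝓣` and a `LocalSubconvergence` datum of `(𝓣, q' n)` to `(𝓢, p')`: drop the finitely
many indices before `p'` enters the exhaustion (`eventually_mem_U`, `subseq` along `n ↦ n₀ + n`) and set
`q' (sub (n₀ + n)) := embed (n₀ + n) p'` (well defined by injectivity of `sub`; arbitrary off the range of `sub`). All other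
clauses are inherited verbatim. [cite: Petersen2006, Ch. 10 §3.2] -/
theorem exists_localSubconvergence_rebase {𝓣 : Spacetime.{0} 4} {q : ℕ → 𝓣.carrier} {𝓢 : Spacetime.{0} 4}
    {p : 𝓢.carrier} {k : ℕ} (Dat : Spacetime.LocalSubconvergence (fun _ ↦ 𝓣) q 𝓢 p k) (p' : 𝓢.carrier) :
    ∃ q' : ℕ → 𝓣.carrier, Nonempty (Spacetime.LocalSubconvergence (fun _ ↦ 𝓣) q' 𝓢 p' k) := by
  classical
  obtain ⟨n₀, hn₀⟩ := (Dat.eventually_mem_U p').exists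
  have hρ : StrictMono fun n : ℕ ↦ n₀ + n := fun a b hab ↦ Nat.add_lt_add_left hab n₀
  set D₁ := Dat.subseq (fun n ↦ n₀ + n) hρ with hD₁
  have hmem : p' ∈ D₁.U 0 := hn₀
  refine ⟨fun m ↦ if h : ∃ n, D₁.sub n = m then D₁.embed (Classical.choose h) p' else D₁.embed 0 p', ⟨?_⟩⟩
  exact
    { sub := D₁.sub
      strictMono_sub := D₁.strictMono_sub
      U := D₁.U
      monotone_U := D₁.monotone_U
      mem_U := hmem
      iUnion_U := D₁.iUnion_U
      isCompact_closure_U := D₁.isCompact_closure_U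
      embed := D₁.embed
      isLocalDiffeomorphOn_embed := D₁.isLocalDiffeomorphOn_embed
      injOn_embed := D₁.injOn_embed
      embed_basepoint := fun n ↦ by
        have h : ∃ n', D₁.sub n' = D₁.sub n := ⟨n, rfl⟩
        show D₁.embed n p' = if h : ∃ n', D₁.sub n' = D₁.sub n then D₁.embed (Classical.choose h) p'
          else D₁.embed 0 p'
        rw [dif_pos h, D₁.strictMono_sub.injective (Classical.choose_spec h)]
      isFutureDirected_mfderiv_embed := D₁.isFutureDirected_mfderiv_embed
      tendsto_supCkENorm := D₁.tendsto_supCkENorm }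

/-- **Pointed `Cᵏ_loc` limits can be re-based at every point of the limit** (constant sequence of spacetimes): if
`(𝓣, q n) ⇀ (𝓢, p)` then for every `p' ∈ 𝓢` there is a base sequence `q'` with `(𝓣, q' n) ⇀ (𝓢, p')`.
[cite: Petersen2006, Ch. 10 §3.2] -/
theorem subconvergesLocallyTo_rebase {𝓣 : Spacetime.{0} 4} {q : ℕ → 𝓣.carrier} {𝓢 : Spacetime.{0} 4}
    {p : 𝓢.carrier} {k : ℕ} (h : Spacetime.SubconvergesLocallyTo (fun _ ↦ 𝓣) q 𝓢 p k) (p' : 𝓢.carrier) :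
    ∃ q' : ℕ → 𝓣.carrier, Spacetime.SubconvergesLocallyTo (fun _ ↦ 𝓣) q' 𝓢 p' k := by
  obtain ⟨Dat⟩ := h
  exact exists_localSubconvergence_rebase Dat p'

/-! ### Re-basing hull elements (registered sub-goal of S3) -/

/-- **Registered sub-goal `stub_hullElement_rebase` of S3.** Every point `p'` of the limit of a hull element
`(𝓢, E, p)` on `q` is the base point of a pointed `C²_loc` subconvergence from SOME sequence `q'` of `𝒟`, with the same
tame end `E`: all clauses of `IsHullElement 𝒟 Λ r₀ q' 𝓢 E p'` hold except `IsFutureEscaping 𝒟 q'` (outer and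
future-escaping), which the posited interface cannot supply (no landing clause for the comparison maps) but which every
honest extraction has. This is the formal half of the far re-basing that makes S3's window hypothesis inert. [folklore] -/
theorem stub_hullElement_rebase :
    ∀ {X : Type} [TopologicalSpace X] [ChartedSpace E3 X] [IsManifold (𝓡 3) ∞ X] [T2Space X]
      [SecondCountableTopology X] [ConnectedSpace X] {D : InitialDataSet (𝓡 3) X}
      (𝒟 : VacuumCauchyDevelopment D) [𝒟.metric.HasLeviCivita] {Λ : ℝ≥0} {r₀ : ℝ} {q : ℕ → 𝒟.carrier}
      {𝓢 : Spacetime.{0} 4} {E : EndDatum 𝓢} {p : 𝓢.carrier}, IsHullElement 𝒟 Λ r₀ q 𝓢 E p →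
        ∀ p' : 𝓢.carrier, ∃ q' : ℕ → 𝒟.carrier,
          E.IsTameEnd Λ r₀ ∧ Spacetime.SubconvergesLocallyTo (fun _ ↦ 𝒟.toSpacetime) q' 𝓢 p' 2 := by
  intro X _ _ _ _ _ _ D 𝒟 _ Λ r₀ q 𝓢 E p hhull p'
  obtain ⟨q', hq'⟩ := subconvergesLocallyTo_rebase hhull.subconverges p'
  exact ⟨q', hhull.isTameEnd, hq'⟩

/-- **Re-based hull elements.** If the re-based sequence is outer and future-escaping, `(𝓢, E, p')` is a hull element on
it — the same end `E`, a new base point anywhere in the limit. [folklore] -/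
theorem isHullElement_rebase {X : Type} [TopologicalSpace X] [ChartedSpace E3 X] [IsManifold (𝓡 3) ∞ X] [T2Space X]
    [SecondCountableTopology X] [ConnectedSpace X] {D : InitialDataSet (𝓡 3) X}
    (𝒟 : VacuumCauchyDevelopment D) [𝒟.metric.HasLeviCivita] {Λ : ℝ≥0} {r₀ : ℝ} {q : ℕ → 𝒟.carrier}
    {𝓢 : Spacetime.{0} 4} {E : EndDatum 𝓢} {p : 𝓢.carrier} (hhull : IsHullElement 𝒟 Λ r₀ q 𝓢 E p)
    (p' : 𝓢.carrier) :
    ∃ q' : ℕ → 𝒟.carrier, Spacetime.SubconvergesLocallyTo (fun _ ↦ 𝒟.toSpacetime) q' 𝓢 p' 2 ∧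
      (IsFutureEscaping 𝒟 q' → IsHullElement 𝒟 Λ r₀ q' 𝓢 E p') := by
  obtain ⟨q', htame, hq'⟩ := stub_hullElement_rebase 𝒟 hhull p'
  exact ⟨q', hq', fun hesc ↦ ⟨hesc, htame, hq'⟩⟩

end Summit.FinalStateConjecture.FinalStateConjecture.Theorems

end
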